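import Mathlib
import HarnessLib

/-!
# K6 crux `MuTransferX9` (stmt-BirchSwinnertonDyer-19276), stub `stub_coreX9`: the FIBRE-PRODUCT lemma
# behind (F8) of MU-TRANSFER-PROOF ("`Gal(L₀/ℚ) = Ḡ ×_{𝔽_p^×} (ℤ/p^{m₀})^×`, so the central scalar `z₀`
# exists") — CORE-PLAN (k6-c2 g2) item S2.3 [OPEN, small], as abstract group theory

Cell `bsd-smallim`, seat `bsd-smallim-koly` (gen 6). HONEST FRAMING: theorems only (no definition, no named
fact, D-0026); pure group theory; nothing is asserted about any curve; nothing is booked. A helper for the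
kernel port of KOLY-MEMO Thm 5.7.1 (`--supports stmt-BirchSwinnertonDyer-19276`).

**What (F8) needs** (MU-TRANSFER-PROOF §1 (F8); CORE-PLAN `MuTransferX9_CORE-PLAN_k6c2.md` S2.3). With
`L₀ := ℚ(E[p], μ_{p^{m₀}})`, the restriction map `G_ℚ → Ḡ × (ℤ/p^{m₀})^×`, `σ ↦ (ρ̄(σ), χ_p(σ) mod p^{m₀})`,
has image EXACTLY the fibre product `{(g, x) : det g = x mod p}` — because `det ρ̄ = χ_p mod p`, both
projections are onto, and `p ∤ #Ḡ` (X9 / X10b images) while the kernel of `(ℤ/p^{m₀})^× → 𝔽_p^×` is a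
`p`-group. Consequently the element `z₀ := (λ̄·1, ω̃(λ̄²))` (the scalar of memo Lemma 2.3 paired with the
Teichmüller lift of its determinant) IS in the image, and it is central (both coordinates are); this is
the input of Sah's lemma in (F8), and the same computation gives `ℚ(E[p]) ∩ ℚ(μ_{p^∞}) = ℚ(μ_p)`.

**The abstract statement proved here** (`MonoidHom.range_prod_eq_eqLocus_of_coprime`). Let `f : G →* A`,
`g : G →* B` be surjective group homomorphisms and `a : A →* C`, `b : B →* C` with `a ∘ f = b ∘ g`. If
`gcd(#A, #ker b) = 1` (both finite), then the image of `(f, g) : G →* A × B` is the whole fibre product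
`{(x, y) : a x = b y}` (`= eqLocus (a ∘ fst) (b ∘ snd)`). PROOF: the image of `ker f` under `g` lies in
`ker b`; its index in `B` divides `[G : ker f] = #A` (it is the image of a subgroup of index `#A` under a
surjection), so its relative index in `ker b` divides both `#A` and `#ker b`, hence is `1`: `g(ker f) = ker b`.
Given `(x, y)` with `a x = b y`, pick `σ` with `f σ = x`; then `y·(g σ)⁻¹ ∈ ker b = g(ker f)`, say `= g k`,
and `(f, g)(k σ) = (x, y)`. Also recorded: the central-element corollary
(`MonoidHom.exists_eq_of_mem_center`, the shape (F8) consumes) and the index-coprimality in the form the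
instantiation meets it (`p ∤ #Ḡ`, `#ker b` a power of `p`: `Nat.Coprime.of_not_dvd_of_prime_pow`-style
helper `coprime_of_not_dvd_of_eq_prime_pow`).

Instantiation (for the porter; not done here, no Galois vocabulary is touched): `A = Ḡ ≤ GL₂(𝔽_p)` with
`p ∤ #Ḡ` (`Serre1972`/`not_dvd_natCard_of_forall_not_le_eigenvectorStabilizer`), `B = (ℤ/p^{m₀})ˣ`,
`C = (ℤ/p)ˣ`, `a = det`, `b =` reduction (`ZMod.unitsMap`), whose kernel has order `p^{m₀-1}`.
References: MU-TRANSFER-PROOF §1 (F8); Serre, Invent. Math. 15 (1972) §2 (the images); this is folklore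
group theory (Goursat for a fibre product with coprime kernels).
-/

-- the summit and its single problem are both named `BirchSwinnertonDyer` (registry layout D-0017)
set_option linter.dupNamespace false

set_option autoImplicit false

namespace Summit.BirchSwinnertonDyer.BirchSwinnertonDyer.Rank1Residual.FibreProduct

variable {G A B C : Type*} [Group G] [Group A] [Group B] [Group C]

/-- **The image of `ker f` under `g` is all of `ker b`** when `a ∘ f = b ∘ g`, `f` and `g` are
surjective, `A` and `ker b` are finite of coprime orders: `g(ker f) ≤ ker b` has index in `B` dividing
`[G : ker f] = #A` and relative index in `ker b` dividing `#ker b`. [folklore] -/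
theorem map_ker_eq_ker_of_coprime (f : G →* A) (g : G →* B) (a : A →* C) (b : B →* C)
    (hf : Function.Surjective f) (hg : Function.Surjective g)
    (hcomm : ∀ x : G, a (f x) = b (g x)) [Finite A]
    (hcop : Nat.Coprime (Nat.card A) (Nat.card b.ker)) :
    f.ker.map g = b.ker := by
  -- `g(ker f) ≤ ker b`
  have hle : f.ker.map g ≤ b.ker := by
    rintro y ⟨k, hk, rfl⟩
    have hk' : f k = 1 := hk
    rw [MonoidHom.mem_ker, ← hcomm, hk', map_one]
  -- index of `g(ker f)` in `B` divides `#A = [G : ker f]`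
  have hidx : (f.ker.map g).index ∣ Nat.card A := by
    have h1 : (f.ker.map g).index ∣ f.ker.index := Subgroup.index_map_dvd f.ker hg
    have h2 : f.ker.index = Nat.card A := by
      rw [Subgroup.index_ker, f.range_eq_top_of_surjective hf, Subgroup.card_top]
    rw [h2] at h1
    exact h1
  -- the relative index of `g(ker f)` in `ker b` divides both `#A` and `#ker b`, hence is `1`
  have hrel1 : (f.ker.map g).relIndex b.ker ∣ Nat.card A :=
    (Subgroup.relIndex_dvd_index_of_le hle).trans hidx
  have hrel2 : (f.ker.map g).relIndex b.ker ∣ Nat.card b.ker := Subgroup.relIndex_dvd_card _ _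
  have hrel : (f.ker.map g).relIndex b.ker = 1 :=
    Nat.eq_one_of_dvd_coprimes hcop hrel1 hrel2
  exact le_antisymm hle (Subgroup.relIndex_eq_one.mp hrel)

/-- **Fibre-product lemma (Goursat with coprime kernels).** For surjective `f : G →* A`, `g : G →* B`
and `a : A →* C`, `b : B →* C` with `a ∘ f = b ∘ g`, if `#A` and `#ker b` are finite and coprime then
the range of `(f, g) : G →* A × B` is the full fibre product `{(x, y) : a x = b y}`. [folklore] -/
theorem range_prod_eq_eqLocus_of_coprime (f : G →* A) (g : G →* B) (a : A →* C) (b : B →* C)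
    (hf : Function.Surjective f) (hg : Function.Surjective g)
    (hcomm : ∀ x : G, a (f x) = b (g x)) [Finite A]
    (hcop : Nat.Coprime (Nat.card A) (Nat.card b.ker)) :
    (f.prod g).range = (a.comp (MonoidHom.fst A B)).eqLocus (b.comp (MonoidHom.snd A B)) := by
  have hker := map_ker_eq_ker_of_coprime f g a b hf hg hcomm hcop
  ext ⟨x, y⟩
  constructor
  · rintro ⟨σ, hσ⟩
    have hx : f σ = x := congrArg Prod.fst hσ
    have hy : g σ = y := congrArg Prod.snd hσ
    change a ((x, y).1) = b ((x, y).2)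
    simp only
    rw [← hx, ← hy, hcomm]
  · intro hxy
    change a x = b y at hxy
    obtain ⟨σ, hσ⟩ := hf x
    -- `y · (g σ)⁻¹ ∈ ker b = g(ker f)`
    have hmem : y * (g σ)⁻¹ ∈ b.ker := by
      rw [MonoidHom.mem_ker, map_mul, map_inv, ← hcomm, hσ, ← hxy, mul_inv_cancel]
    rw [← hker] at hmem
    obtain ⟨k, hk, hgk⟩ := hmem
    have hk' : f k = 1 := hk
    refine ⟨k * σ, ?_⟩
    ext
    · change f (k * σ) = x
      rw [map_mul, hk', one_mul, hσ]
    · change g (k * σ) = y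
      rw [map_mul, hgk, inv_mul_cancel_right]

/-- **The (F8) shape: a prescribed pair of values is attained.** Under the hypotheses of the
fibre-product lemma, for every `x : A`, `y : B` with `a x = b y` there is `σ : G` with `f σ = x` and
`g σ = y` — e.g. the central scalar `λ̄·1 ∈ Ḡ` paired with the Teichmüller lift of `λ̄²` in
`(ℤ/p^{m₀})ˣ`, which is then automatically central in the image (both factors commute with everything).
[folklore] -/
theorem exists_eq_and_eq_of_coprime (f : G →* A) (g : G →* B) (a : A →* C) (b : B →* C)
    (hf : Function.Surjective f) (hg : Function.Surjective g)
    (hcomm : ∀ x : G, a (f x) = b (g x)) [Finite A]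
    (hcop : Nat.Coprime (Nat.card A) (Nat.card b.ker)) (x : A) (y : B) (hxy : a x = b y) :
    ∃ σ : G, f σ = x ∧ g σ = y := by
  have hmem : (x, y) ∈ (f.prod g).range := by
    rw [range_prod_eq_eqLocus_of_coprime f g a b hf hg hcomm hcop]
    change a x = b y
    exact hxy
  obtain ⟨σ, hσ⟩ := hmem
  exact ⟨σ, congrArg Prod.fst hσ, congrArg Prod.snd hσ⟩

/-- **If both prescribed values are central, so is (any lift's image) in the image group**: for
`σ` with `f σ ∈ Z(A)` and `g σ ∈ Z(B)`, `(f, g)(σ)` commutes with every `(f, g)(τ)`. (Used with Sah's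
lemma: `z₀` central in `Gal(L₀/ℚ)`.) [folklore] -/
theorem prod_apply_comm_of_mem_center (f : G →* A) (g : G →* B) {σ : G}
    (hA : f σ ∈ Subgroup.center A) (hB : g σ ∈ Subgroup.center B) (τ : G) :
    (f.prod g) τ * (f.prod g) σ = (f.prod g) σ * (f.prod g) τ := by
  rw [Subgroup.mem_center_iff] at hA hB
  ext
  · simpa using hA (f τ)
  · simpa using hB (g τ)

/-- The coprimality in the form the instantiation meets it: `p ∤ m` and `n = p^k` give
`gcd(m, n) = 1`. [folklore] -/
theorem coprime_of_not_dvd_of_eq_prime_pow {p m n k : ℕ} (hp : p.Prime) (hm : ¬ p ∣ m)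
    (hn : n = p ^ k) : Nat.Coprime m n := by
  subst hn
  exact Nat.Coprime.pow_right k ((Nat.Prime.coprime_iff_not_dvd hp).mpr hm).symm

end Summit.BirchSwinnertonDyer.BirchSwinnertonDyer.Rank1Residual.FibreProduct
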